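import Summits.ABC.IUTFork.Conditional.WRowFrey37569208117Packages
import HarnessLib

/-!
# R-W WINDOW-TABLE «W:GAP-1019» completion — cells for the TWISTED-TYPE BAND: the hooked slot socket's arithmetic for
# `7¹¹·19 + 5¹²·1019·7151² = 2²⁸·3¹²·11³·67` at EVERY prime `l ≥ 821` with the pole `7` pinned to `e = 30·l`

PROOF-ONLY file (D-0012; 0 definitions, 0 `Prop` facts; integer arithmetic only) of the abc-iut cell — D-0079 RESCUE sub-cell R-W «WINDOW Θ-SIDE
INEQUALITY», seat abc-iut-w5-d009 (gen 14), row «W:GAP-1019» (TYPE-SPLIT class, abc-iut-plan C-R83 (b) / C-R87 (c)), completion of the l-axis of the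
triple below the hypothesis-free band (`WRowFrey37569208117AllLevels`, `l ≥ 1663`): on the sub-class «twist factor at 7» (`e(K_x/ℚ₇) = 30·l`) the
licence holds from `l = 821` on (consumer: `WRowFrey37569208117GapThirtyBand` over abc-iut-W-row-1's hooked socket `WRow.licence_triple_slot_of_localType`,
p494895), uniformly in `l`; the fixed level `l = 1019` is `WRowFrey37569208117GapThirtyCells` / `…GapThirty` (p495873 / p496283). TAKES NO SIDE on
[IUTchIII] Cor. 3.12 or on any author. Desk (work/bands.py of this seat): with `e₀ = 30·l` at `7` the floor-free END cells pass at every prime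
`l ≥ 821` and FAIL at every prime `401 ≤ l ≤ 811` (there BOTH local types fail: `WRowFrey37569208117GapRefutedBand`). HONEST SCOPE: integer arithmetic
only; nothing here bears on the printed inequality; no abc claim. [folklore]
-/

noncomputable section

open Set Function Metric NumberField IsDedekindDomain

namespace Summit.ABC.IUTFork.Conditional

open Thm311 Thm311.Real Cor312 Cor312Vol Cor312Prov Literature.IUT.LogThetaLattice Literature.IUT.LogVolume
  Literature.IUT.HodgeTheaters Literature.IUT.LogVolume.Cor22
open Literature.NumberTheory.NumberFields Literature.NumberTheory.GaloisRepresentations.Ultrametric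
open Literature.NumberTheory.DiophantineGeometry Literature.NumberTheory.DiophantineGeometry.GenEll

/-! ## The hooked arithmetic at a symbolic prime level `l ≥ 821`, pole `7` pinned to the twisted type `e = 30·l` -/

/-- **The HOOKED slot socket's `hcell` for `(7¹¹·19, 5¹²·1019·7151², 2²⁸·3¹²·11³·67)` at EVERY prime level `l ≥ 821`, hook `Q p e := (p = 7 → e = 30·l)`.**
Per prime of `abc` other than `2, l` the cells are those of `WRow.hcell_frey37569208117_all` (`WRowFrey37569208117Packages`) except at `7`, where the
hook pins the twisted type `e = 30·l·n` (slot `5l·n`, `A = 5`): floor-free top cell `−40L² + 16313L + 16322 ≤ 0` iff `L = (l−1)/2 ≥ 409`, i.e.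
`l ≥ 819` (first prime `821`); the other thresholds (`L ≥ 8` at `3`, `L ≥ 34` at `5`) are far below. [folklore] -/
theorem WRow.hcell_frey37569208117_gap_localType30 {l : ℕ} (hl : l.Prime) (hl0 : 821 ≤ l) :
    ∀ p : ℕ, p.Prime → p ∣ 7 ^ 11 * 19 * (5 ^ 12 * 1019 * 7151 ^ 2) * (2 ^ 28 * 3 ^ 12 * 11 ^ 3 * 67) → p ≠ 2 → p ≠ l → ∀ e : ℕ, 0 < e → l ∣ e →
      15 * l ∣ e * (7 ^ 11 * 19 * (5 ^ 12 * 1019 * 7151 ^ 2) * (2 ^ 28 * 3 ^ 12 * 11 ^ 3 * 67)).factorization p → (p ∣ 30 → (p - 1) ∣ e) →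
      (p ∣ 2 ^ 28 * 3 ^ 12 * 11 ^ 3 * 67 → Odd ((7 ^ 11 * 19 * (5 ^ 12 * 1019 * 7151 ^ 2) * (2 ^ 28 * 3 ^ 12 * 11 ^ 3 * 67)).factorization p) →
        30 * l ∣ e * (7 ^ 11 * 19 * (5 ^ 12 * 1019 * 7151 ^ 2) * (2 ^ 28 * 3 ^ 12 * 11 ^ 3 * 67)).factorization p) → (p = 7 → e = 30 * l) →
      (∀ k : ℕ, (e : ℤ) ≠ (p : ℤ) ^ k * ((p : ℤ) - 1)) ∧
      ∀ i : ℕ, i < (l - 1) / 2 →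
        (e : ℤ) * ((((i + 1 : ℕ) : ℤ) ^ 2 * ((e * (2 * (7 ^ 11 * 19 * (5 ^ 12 * 1019 * 7151 ^ 2) * (2 ^ 28 * 3 ^ 12 * 11 ^ 3 * 67)).factorization p) / (2 * l) : ℕ) : ℤ) -
            ((i + 1 : ℕ) : ℤ) * (((if p ∣ 30 ∧ ¬ p ∣ (7 ^ 11 * 19 * (5 ^ 12 * 1019 * 7151 ^ 2) * (2 ^ 28 * 3 ^ 12 * 11 ^ 3 * 67)).factorization p
              then 2 * e - 1 else e - 1 : ℕ) : ℕ) : ℤ) -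
            ((i + 2 : ℕ) : ℤ) * ((((max 1 (e / (p - 1))) : ℕ) : ℤ))) / (e : ℤ)) +
          ((i + 2 : ℕ) : ℤ) * min ((p : ℤ) ^ (if p = 3 then 5 else if p = 5 then 4 else if p = 7 then 5 else if p = 11 then 1 else 0) -
              ((if p = 3 then 5 else if p = 5 then 4 else if p = 7 then 5 else if p = 11 then 1 else 0 : ℕ) : ℤ) * (e : ℤ))
            ((p : ℤ) ^ (if p = 3 then 6 else if p = 5 then 5 else if p = 7 then 6 else if p = 11 then 2 else 1) -
              ((if p = 3 then 6 else if p = 5 then 5 else if p = 7 then 6 else if p = 11 then 2 else 1 : ℕ) : ℤ) * (e : ℤ)) ≤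
        ((e * (2 * (7 ^ 11 * 19 * (5 ^ 12 * 1019 * 7151 ^ 2) * (2 ^ 28 * 3 ^ 12 * 11 ^ 3 * 67)).factorization p) / (2 * l) : ℕ) : ℤ) := by
  intro p hp hpabc h2 hpl e he hle h15 h30 hodd hq7
  have hl2 : Nat.Coprime l 2 := (Nat.coprime_primes hl Nat.prime_two).mpr (by omega)
  rcases WRow.eq_of_prime_dvd_frey37569208117 hp hpabc with rfl | rfl | rfl | rfl | rfl | rfl | rfl | rfl | rfl
  · exact absurd rfl h2
  · -- `p = 3`: `v = 12`, `e = 10·l·n`, tame different, slot `5l·n`, `A = 5`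
    rw [WRow.factorization_frey37569208117.1] at h15 hodd ⊢
    have h5l : 5 * l ∣ e := by
      have h' : 5 * l * 3 ∣ e * 4 * 3 := by
        rw [show 5 * l * 3 = 15 * l by ring, show e * 4 * 3 = e * 12 by ring]; exact h15
      exact (Nat.Coprime.mul_left (by norm_num) (by simpa using hl2.pow_right 2) : Nat.Coprime (5 * l) 4).dvd_of_dvd_mul_right
        (Nat.dvd_of_mul_dvd_mul_right (by norm_num) h')
    have hq : 2 ∣ e := by have := h30 (by norm_num); norm_num at this; exact this
    have he0 : 10 * l ∣ e := by
      have hc : Nat.Coprime 2 (5 * l) := Nat.Coprime.mul_right (by norm_num) hl2.symm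
      have := Nat.Coprime.mul_dvd_of_dvd_of_dvd hc hq h5l; rwa [← mul_assoc, show (2 : ℕ) * 5 = 10 by norm_num] at this
    obtain ⟨n, rfl⟩ := he0
    have hn : 1 ≤ n := Nat.pos_of_ne_zero (by rintro rfl; simp at he)
    refine ⟨WRow.natCast_ne_pow_mul_sub_one (by norm_num : Nat.Prime 5) (by norm_num) (by norm_num) (by norm_num)
      ⟨2 * l * n, by ring⟩, fun i hi => ?_⟩
    rw [if_neg (by norm_num : ¬ ((3 : ℕ) ∣ 30 ∧ ¬ (3 : ℕ) ∣ 12))]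
    simp only [ite_true]
    refine WRow.cell_tameslot_of_ends ((3 : ℕ) : ℤ) (10 * l) (3 - 1) (5 * l) (2 * 12) (2 * l) 5 6 ((l - 1) / 2) 1 (by norm_num) (by norm_num)
      (by omega) (by omega) ⟨120, by ring⟩ (by omega) le_rfl ?_ hi hn
    have hP : 10 * l * (2 * 12) / (2 * l) = 120 := Nat.div_eq_of_eq_mul_left (by omega) (by ring)
    have hpA : (((3 : ℕ) : ℤ)) ^ 5 = 243 := by norm_num
    rintro i (rfl | hi')
    · rw [hP, hpA]; push_cast; omega
    · obtain ⟨k, hk⟩ := hl.odd_of_ne_two (by omega)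
      have hl' : l = 2 * i + 3 := by omega
      subst hl'
      have hi0 : ((408 : ℕ) : ℤ) ≤ (i : ℤ) := by exact_mod_cast (show 408 ≤ i by omega)
      rw [hP, hpA]; push_cast at hi0 ⊢
      nlinarith [sq_nonneg (i : ℤ), mul_nonneg (sub_nonneg.mpr hi0) (show (0 : ℤ) ≤ (i : ℤ) by positivity)]
  · -- `p = 5`: `v = 12`, `e = 20·l·n`, WILD different, slot `5l·n`, `A = 4`
    rw [WRow.factorization_frey37569208117.2.1] at h15 hodd ⊢
    have h5l : 5 * l ∣ e := by
      have h' : 5 * l * 3 ∣ e * 4 * 3 := by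
        rw [show 5 * l * 3 = 15 * l by ring, show e * 4 * 3 = e * 12 by ring]; exact h15
      exact (Nat.Coprime.mul_left (by norm_num) (by simpa using hl2.pow_right 2) : Nat.Coprime (5 * l) 4).dvd_of_dvd_mul_right
        (Nat.dvd_of_mul_dvd_mul_right (by norm_num) h')
    have hq : 4 ∣ e := by have := h30 (by norm_num); norm_num at this; exact this
    have he0 : 20 * l ∣ e := by
      have hc : Nat.Coprime 4 (5 * l) := Nat.Coprime.mul_right (by norm_num) (by simpa using (hl2.pow_right 2).symm)
      have := Nat.Coprime.mul_dvd_of_dvd_of_dvd hc hq h5l; rwa [← mul_assoc, show (4 : ℕ) * 5 = 20 by norm_num] at this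
    obtain ⟨n, rfl⟩ := he0
    have hn : 1 ≤ n := Nat.pos_of_ne_zero (by rintro rfl; simp at he)
    refine ⟨WRow.natCast_ne_pow_mul_sub_one hl (by norm_num) (by omega) (fun h => by have := Nat.le_of_dvd (by norm_num) h; omega)
      ⟨20 * n, by ring⟩, fun i hi => ?_⟩
    rw [if_pos ⟨by norm_num, by norm_num⟩, max_eq_right (show 1 ≤ 20 * l * n / (5 - 1) by
      rw [Nat.le_div_iff_mul_le (by norm_num)]; nlinarith)]
    simp only [show ((5 : ℕ) = 3) = False from eq_false (by decide), ite_true, ite_false]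
    refine WRow.cell_wild_of_ends ((5 : ℕ) : ℤ) (20 * l) (5 - 1) (2 * 12) (2 * l) 4 5 ((l - 1) / 2) (by norm_num) (by norm_num)
      (Dvd.intro (5 * l) (by ring)) (by omega) ⟨240, by ring⟩ (by omega) ?_ hi hn
    have hP : 20 * l * (2 * 12) / (2 * l) = 240 := Nat.div_eq_of_eq_mul_left (by omega) (by ring)
    have hR : 20 * l / (5 - 1) = 5 * l := by omega
    have hpA : (((5 : ℕ) : ℤ)) ^ 4 = 625 := by norm_num
    rintro i (rfl | hi')
    · rw [hP, hR, hpA]; push_cast; omega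
    · obtain ⟨k, hk⟩ := hl.odd_of_ne_two (by omega)
      have hl' : l = 2 * i + 3 := by omega
      subst hl'
      have hi0 : ((408 : ℕ) : ℤ) ≤ (i : ℤ) := by exact_mod_cast (show 408 ≤ i by omega)
      rw [hP, hR, hpA]; push_cast at hi0 ⊢
      nlinarith [sq_nonneg (i : ℤ), mul_nonneg (sub_nonneg.mpr hi0) (show (0 : ℤ) ≤ (i : ℤ) by positivity)]
  · -- `p = 7`: the hook pins the twisted type `e = 30·l` (`·n`); tame, slot `⌊30l·n/6⌋ = 5l·n`, `A = 5` — threshold `L ≥ 409`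
    rw [WRow.factorization_frey37569208117.2.2.1]
    obtain ⟨n, rfl⟩ : 30 * l ∣ e := ⟨1, by rw [hq7 rfl]; ring⟩
    have hn : 1 ≤ n := Nat.pos_of_ne_zero (by rintro rfl; simp at he)
    refine ⟨WRow.natCast_ne_pow_mul_sub_one (by norm_num : Nat.Prime 5) (by norm_num) (by norm_num) (by norm_num)
      ⟨6 * l * n, by ring⟩, fun i hi => ?_⟩
    rw [if_neg (by norm_num : ¬ ((7 : ℕ) ∣ 30 ∧ ¬ (7 : ℕ) ∣ 11))]
    simp only [show ((7 : ℕ) = 3) = False from eq_false (by decide), show ((7 : ℕ) = 5) = False from eq_false (by decide), ite_true, ite_false]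
    refine WRow.cell_tameslot_of_ends ((7 : ℕ) : ℤ) (30 * l) (7 - 1) (5 * l) (2 * 11) (2 * l) 5 6 ((l - 1) / 2) 1 (by norm_num) (by norm_num)
      (by omega) (by omega) ⟨330, by ring⟩ (by omega) le_rfl ?_ hi hn
    have hP : 30 * l * (2 * 11) / (2 * l) = 330 := Nat.div_eq_of_eq_mul_left (by omega) (by ring)
    have hpA : (((7 : ℕ) : ℤ)) ^ 5 = 16807 := by norm_num
    rintro i (rfl | hi')
    · rw [hP, hpA]; push_cast; omega
    · obtain ⟨k, hk⟩ := hl.odd_of_ne_two (by omega)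
      have hl' : l = 2 * i + 3 := by omega
      subst hl'
      have hi0 : ((408 : ℕ) : ℤ) ≤ (i : ℤ) := by exact_mod_cast (show 408 ≤ i by omega)
      rw [hP, hpA]; push_cast at hi0 ⊢
      nlinarith [sq_nonneg (i : ℤ), mul_nonneg (sub_nonneg.mpr hi0) (show (0 : ℤ) ≤ (i : ℤ) by positivity)]
  · -- `p = 11`: `v = 3`, `p ∣ c` odd (twist `30l ∣ 3e`): `e = 10·l·n`, tame, slot `l·n`, `A = 1`
    rw [WRow.factorization_frey37569208117.2.2.2.1] at h15 hodd ⊢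
    have hT : 10 * l ∣ e := by
      have h := hodd (by norm_num) (by decide)
      rw [show 30 * l = 10 * l * 3 by ring] at h
      exact Nat.dvd_of_mul_dvd_mul_right (by norm_num) h
    obtain ⟨n, rfl⟩ := hT
    have hn : 1 ≤ n := Nat.pos_of_ne_zero (by rintro rfl; simp at he)
    refine ⟨WRow.natCast_ne_pow_mul_sub_one hl (by norm_num) (by omega) (fun h => by have := Nat.le_of_dvd (by norm_num) h; omega)
      ⟨10 * n, by ring⟩, fun i hi => ?_⟩
    rw [if_neg (by norm_num : ¬ ((11 : ℕ) ∣ 30 ∧ ¬ (11 : ℕ) ∣ 3))]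
    simp only [show ((11 : ℕ) = 3) = False from eq_false (by decide), show ((11 : ℕ) = 5) = False from eq_false (by decide),
      show ((11 : ℕ) = 7) = False from eq_false (by decide), ite_true, ite_false]
    refine WRow.cell_tameslot_of_ends ((11 : ℕ) : ℤ) (10 * l) (11 - 1) l (2 * 3) (2 * l) 1 2 ((l - 1) / 2) 1 (by norm_num) (by norm_num)
      (by omega) (by omega) ⟨30, by ring⟩ (by omega) le_rfl ?_ hi hn
    have hP : 10 * l * (2 * 3) / (2 * l) = 30 := Nat.div_eq_of_eq_mul_left (by omega) (by ring)
    have hpA : (((11 : ℕ) : ℤ)) ^ 1 = 11 := by norm_num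
    rintro i (rfl | hi')
    · rw [hP, hpA]; push_cast; omega
    · obtain ⟨k, hk⟩ := hl.odd_of_ne_two (by omega)
      have hl' : l = 2 * i + 3 := by omega
      subst hl'
      have hi0 : ((408 : ℕ) : ℤ) ≤ (i : ℤ) := by exact_mod_cast (show 408 ≤ i by omega)
      rw [hP, hpA]; push_cast at hi0 ⊢
      nlinarith [sq_nonneg (i : ℤ), mul_nonneg (sub_nonneg.mpr hi0) (show (0 : ℤ) ≤ (i : ℤ) by positivity)]
  · -- `p = 19`: `v = 1`, `e = 15·l·n`, `A = 0`
    rw [WRow.factorization_frey37569208117.2.2.2.2.1] at h15 hodd ⊢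
    have he0 : 15 * l ∣ e := by simpa using h15
    obtain ⟨n, rfl⟩ := he0
    have hn : 1 ≤ n := Nat.pos_of_ne_zero (by rintro rfl; simp at he)
    refine ⟨WRow.natCast_ne_pow_mul_sub_one (by norm_num : Nat.Prime 5) (by norm_num) (by norm_num) (by norm_num)
      ⟨3 * l * n, by ring⟩, fun i hi => ?_⟩
    rw [if_neg (by norm_num : ¬ ((19 : ℕ) ∣ 30 ∧ ¬ (19 : ℕ) ∣ 1))]
    simp only [show ((19 : ℕ) = 3) = False from eq_false (by decide), show ((19 : ℕ) = 5) = False from eq_false (by decide),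
      show ((19 : ℕ) = 7) = False from eq_false (by decide), show ((19 : ℕ) = 11) = False from eq_false (by decide), ite_false]
    refine WRow.cell_tameslot_of_ends ((19 : ℕ) : ℤ) (15 * l) (19 - 1) 0 (2 * 1) (2 * l) 0 1 ((l - 1) / 2) 1 (by norm_num) (by norm_num)
      (by omega) (by omega) ⟨15, by ring⟩ (by omega) le_rfl ?_ hi hn
    have hP : 15 * l * (2 * 1) / (2 * l) = 15 := Nat.div_eq_of_eq_mul_left (by omega) (by ring)
    have hpA : (((19 : ℕ) : ℤ)) ^ 0 = 1 := by norm_num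
    rintro i (rfl | hi')
    · rw [hP, hpA]; push_cast; omega
    · obtain ⟨k, hk⟩ := hl.odd_of_ne_two (by omega)
      have hl' : l = 2 * i + 3 := by omega
      subst hl'
      have hi0 : ((408 : ℕ) : ℤ) ≤ (i : ℤ) := by exact_mod_cast (show 408 ≤ i by omega)
      rw [hP, hpA]; push_cast at hi0 ⊢
      nlinarith [sq_nonneg (i : ℤ), mul_nonneg (sub_nonneg.mpr hi0) (show (0 : ℤ) ≤ (i : ℤ) by positivity)]
  · -- `p = 67`: `v = 1`, `p ∣ c` odd (twist): `e = 30·l·n`, `A = 0`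
    rw [WRow.factorization_frey37569208117.2.2.2.2.2.1] at h15 hodd ⊢
    have hT : 30 * l ∣ e := by simpa using hodd (by norm_num) (by decide)
    obtain ⟨n, rfl⟩ := hT
    have hn : 1 ≤ n := Nat.pos_of_ne_zero (by rintro rfl; simp at he)
    refine ⟨WRow.natCast_ne_pow_mul_sub_one (by norm_num : Nat.Prime 5) (by norm_num) (by norm_num) (by norm_num)
      ⟨6 * l * n, by ring⟩, fun i hi => ?_⟩
    rw [if_neg (by norm_num : ¬ ((67 : ℕ) ∣ 30 ∧ ¬ (67 : ℕ) ∣ 1))]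
    simp only [show ((67 : ℕ) = 3) = False from eq_false (by decide), show ((67 : ℕ) = 5) = False from eq_false (by decide),
      show ((67 : ℕ) = 7) = False from eq_false (by decide), show ((67 : ℕ) = 11) = False from eq_false (by decide), ite_false]
    refine WRow.cell_tameslot_of_ends ((67 : ℕ) : ℤ) (30 * l) (67 - 1) 0 (2 * 1) (2 * l) 0 1 ((l - 1) / 2) 1 (by norm_num) (by norm_num)
      (by omega) (by omega) ⟨30, by ring⟩ (by omega) le_rfl ?_ hi hn
    have hP : 30 * l * (2 * 1) / (2 * l) = 30 := Nat.div_eq_of_eq_mul_left (by omega) (by ring)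
    have hpA : (((67 : ℕ) : ℤ)) ^ 0 = 1 := by norm_num
    rintro i (rfl | hi')
    · rw [hP, hpA]; push_cast; omega
    · obtain ⟨k, hk⟩ := hl.odd_of_ne_two (by omega)
      have hl' : l = 2 * i + 3 := by omega
      subst hl'
      have hi0 : ((408 : ℕ) : ℤ) ≤ (i : ℤ) := by exact_mod_cast (show 408 ≤ i by omega)
      rw [hP, hpA]; push_cast at hi0 ⊢
      nlinarith [sq_nonneg (i : ℤ), mul_nonneg (sub_nonneg.mpr hi0) (show (0 : ℤ) ≤ (i : ℤ) by positivity)]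
  · -- `p = 1019` (`≠ l` since `l ≥ 1663`): `v = 1`, `e = 15·l·n`, `A = 0`
    rw [WRow.factorization_frey37569208117.2.2.2.2.2.2.1] at h15 hodd ⊢
    have he0 : 15 * l ∣ e := by simpa using h15
    obtain ⟨n, rfl⟩ := he0
    have hn : 1 ≤ n := Nat.pos_of_ne_zero (by rintro rfl; simp at he)
    refine ⟨WRow.natCast_ne_pow_mul_sub_one (by norm_num : Nat.Prime 5) (by norm_num) (by norm_num) (by norm_num)
      ⟨3 * l * n, by ring⟩, fun i hi => ?_⟩
    rw [if_neg (by norm_num : ¬ ((1019 : ℕ) ∣ 30 ∧ ¬ (1019 : ℕ) ∣ 1))]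
    simp only [show ((1019 : ℕ) = 3) = False from eq_false (by decide), show ((1019 : ℕ) = 5) = False from eq_false (by decide),
      show ((1019 : ℕ) = 7) = False from eq_false (by decide), show ((1019 : ℕ) = 11) = False from eq_false (by decide), ite_false]
    refine WRow.cell_tameslot_of_ends ((1019 : ℕ) : ℤ) (15 * l) (1019 - 1) 0 (2 * 1) (2 * l) 0 1 ((l - 1) / 2) 1 (by norm_num) (by norm_num)
      (by omega) (by omega) ⟨15, by ring⟩ (by omega) le_rfl ?_ hi hn
    have hP : 15 * l * (2 * 1) / (2 * l) = 15 := Nat.div_eq_of_eq_mul_left (by omega) (by ring)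
    have hpA : (((1019 : ℕ) : ℤ)) ^ 0 = 1 := by norm_num
    rintro i (rfl | hi')
    · rw [hP, hpA]; push_cast; omega
    · obtain ⟨k, hk⟩ := hl.odd_of_ne_two (by omega)
      have hl' : l = 2 * i + 3 := by omega
      subst hl'
      have hi0 : ((408 : ℕ) : ℤ) ≤ (i : ℤ) := by exact_mod_cast (show 408 ≤ i by omega)
      rw [hP, hpA]; push_cast at hi0 ⊢
      nlinarith [sq_nonneg (i : ℤ), mul_nonneg (sub_nonneg.mpr hi0) (show (0 : ℤ) ≤ (i : ℤ) by positivity)]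
  · -- `p = 7151`: `v = 2`, `e = 15·l·n`, `A = 0`
    rw [WRow.factorization_frey37569208117.2.2.2.2.2.2.2] at h15 hodd ⊢
    have he0 : 15 * l ∣ e := (Nat.Coprime.mul_left (by norm_num) hl2 : Nat.Coprime (15 * l) 2).dvd_of_dvd_mul_right h15
    obtain ⟨n, rfl⟩ := he0
    have hn : 1 ≤ n := Nat.pos_of_ne_zero (by rintro rfl; simp at he)
    refine ⟨WRow.natCast_ne_pow_mul_sub_one (by norm_num : Nat.Prime 3) (by norm_num) (by norm_num) (by norm_num)
      ⟨5 * l * n, by ring⟩, fun i hi => ?_⟩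
    rw [if_neg (by norm_num : ¬ ((7151 : ℕ) ∣ 30 ∧ ¬ (7151 : ℕ) ∣ 2))]
    simp only [show ((7151 : ℕ) = 3) = False from eq_false (by decide), show ((7151 : ℕ) = 5) = False from eq_false (by decide),
      show ((7151 : ℕ) = 7) = False from eq_false (by decide), show ((7151 : ℕ) = 11) = False from eq_false (by decide), ite_false]
    refine WRow.cell_tameslot_of_ends ((7151 : ℕ) : ℤ) (15 * l) (7151 - 1) 0 (2 * 2) (2 * l) 0 1 ((l - 1) / 2) 1 (by norm_num) (by norm_num)
      (by omega) (by omega) ⟨30, by ring⟩ (by omega) le_rfl ?_ hi hn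
    have hP : 15 * l * (2 * 2) / (2 * l) = 30 := Nat.div_eq_of_eq_mul_left (by omega) (by ring)
    have hpA : (((7151 : ℕ) : ℤ)) ^ 0 = 1 := by norm_num
    rintro i (rfl | hi')
    · rw [hP, hpA]; push_cast; omega
    · obtain ⟨k, hk⟩ := hl.odd_of_ne_two (by omega)
      have hl' : l = 2 * i + 3 := by omega
      subst hl'
      have hi0 : ((408 : ℕ) : ℤ) ≤ (i : ℤ) := by exact_mod_cast (show 408 ≤ i by omega)
      rw [hP, hpA]; push_cast at hi0 ⊢
      nlinarith [sq_nonneg (i : ℤ), mul_nonneg (sub_nonneg.mpr hi0) (show (0 : ℤ) ≤ (i : ℤ) by positivity)]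

end Summit.ABC.IUTFork.Conditional

end
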